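import Summits.QuantumFields.BalabanUV.T4Continuum.Support.RegionScalarCompression
import Summits.QuantumFields.BalabanUV.T4Continuum.Support.DirichletScalarTowerBox
import Summits.QuantumFields.BalabanUV.T4Continuum.Support.GaugeTermScalarData

/-!
# T⁴ programme, spine node NE2 (U1a), sub-row Δ1 «NE2⁰-Dirichlet» — THE TWO-LEVEL LAW OF THE REGION GRAM MATRIX
# `K_Ω = Q′_ΩG′_Ω²Q′_Ω*` ON A COORDINATE BOX at the torus rate: `‖K_{Rn}⁻¹ − K_n⁻¹‖ ≤ 2σ₀⁻⁴γ′⁻¹·Cbox/n`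

NE2 formalisation swarm `b2b-balaban-t4-ne2-formalise-*`, LEAF PROVER 01 (gen 10), supplier item «Δ1-VEC-W3-GRAM-TWOLEVEL» = piece
(W-c) of the row-NE2 OWNER's item O15-a «Δ1-VEC-W3-RESOLVENT-SPLIT» (journal `HOME/CLAIMS.log` 2026-08-20 l.21857: the faithful region
operator splits as `Δ_a(Ω₀) = Δ_loc − ∂_Ω·P(Ω₀)·∂_Ωᴴ` with `∂_ΩP∂_Ωᴴ = B̂·KcompR⁻¹·B̂ᴴ` of rank `|S|`; the two-level transfer of the injected law
W3 from `Δ_loc` to `Δ_a(Ω₀)` consumes (W-a) the injected law of `Δ_loc`, (W-b) the gradient two-level law of `B̂`, and (W-c)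
`‖KcompR_{k+1}⁻¹ − KcompR_k⁻¹‖ ≤ C·L^{−k}`).  THIS FILE proves (W-c), by bookkeeping over landed modules:

 * §1 (one step `n ↦ R·n`, ANY region predicate `S`) the NESTING of Bałaban's scalar block averaging through the region with gan24's
   compressed scalar planting `J_Ω = JOm n R M Ω` (`Ω = blockReg n M S`, fine region in the q-spelling `refineR n R M Ω`):
   **`QOmq_eq`** `Q′_{Ω,Rn} = (√(R^d))⁻¹•(Q′_{Ω,n}·J_Ωᴴ)` (`GaugeTermScalarData.QsOp_mul_Qavg0` compressed: `Q′` never couples a block of `S` to a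
   site outside `Ω`), **`JOm_conjTranspose_mul_JOm`** `J_ΩᴴJ_Ω = 1` (every child of an `Ω`-site lies in `Ω′`), and the transport of
   `KcompR (R·n)` to the q-spelling (`DirichletScalarTowerBox.eqv`; the q-spelt `Q′q = (Q′_{Rn})_{S,par⁻¹Ω}` and `G′ = ((Δ′_{Rn})_{par⁻¹Ω,par⁻¹Ω})⁻¹` are written INLINE, no new definition): **`KcompR_fine_eq`** `K_{Rn} = n^d•(Q′_Ω·(J_ΩᴴG′_{Ω′}G′_{Ω′}J_Ω)·Q′_Ωᴴ)`.
 * §2 **`KcompR_fine_sub_eq`** `K_{Rn} − K_n = n^d•(Q′_Ω·X·Q′_Ωᴴ)`, `X = J_ΩᴴG′(G′J_Ω − J_ΩG) + J_Ωᴴ(G′J_Ω − J_ΩG)G`, hence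
   **`opNorm_KcompR_sub_le_of_injected`** `‖K_{Rn} − K_n‖ ≤ 2γ′⁻¹·ε` for ANY region, `ε` = the injected number `‖G′J_Ω − J_ΩG‖`
   (`n^d‖Q′_Ω‖² ≤ 1` by `nsq_QOm_mulVec_le`, `‖G‖, ‖G′‖ ≤ γ′⁻¹` by `opNorm_inv_DOm_le`), and on a COORDINATE BOX, by road P2's END
   `DirichletBoxTwoLevel.injected_le_box` BY NAME: **`opNorm_KcompR_sub_le_box`** `‖K_{Rn} − K_n‖ ≤ 2γ′⁻¹·Cbox d R a′/n`.
 * §3 the inverses: **`opNorm_KcompR_inv_sub_le_box`** `‖K_{Rn}⁻¹ − K_n⁻¹‖ ≤ (σ₀²)⁻¹·(σ₀²)⁻¹·(2γ′⁻¹·Cbox d R a′/n)` (`K′⁻¹ − K⁻¹ =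
   K′⁻¹(K − K′)K⁻¹`, `opNorm_KcompR_inv_le` twice), and ALONG THE TOWER `n_k = lev L k`: **`opNorm_KcompR_inv_sub_le_lev`**
   `‖(KcompR (lev L (k+1)) M a′ S)⁻¹ − (KcompR (lev L k) M a′ S)⁻¹‖ ≤ Cgram d L a′·L^{−k}`, `Cgram = (σ₀²)⁻¹(σ₀²)⁻¹·2γ′⁻¹·Cbox d L a′` —
   the rate `L^{−k}` of O15-a (W-c), level-free constant.  (Both Gram matrices live on the SAME index type `{y // S y}`: no planting on
   the outside.)

HONEST FRAMING (T4-DAG p. 1).  Bookkeeping over landed modules ([folklore]); model level (`U = 1`, ONE region = a coordinate box, ONE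
averaging scale, finite torus, operator norm); nothing printed is a hypothesis ([B9] Thm 3.2 (3.48) p.398 prints only η-UNIFORM bounds for
`(Q′G′²Q′*)⁻¹`; the two-spacing law is «not in print; our proof attempt»); ONE input of ONE transfer identity — W3 on boxes OPEN; Δ1 NOT
closed; NE2 (U1a) NOT proved; spine PROVED 0/9 unchanged; NOT [B9] (3.16)/(3.23)–(3.27)/(3.48) as printed; NOT infinite volume, NOT a
mass gap, NOT the Clay problem, NOT summit progress.  HONEST DEPENDENCY: continuum YM on T⁴ ⇐ BetaPertH ∧ nine spine estimates (0/9
proved); BetaPertH ⇐ (D1) ∧ (D4) ∧ CAP+tail; G-an2-4 gates asym, D1 and NE2/3/4.  No `sorry`.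
-/

noncomputable section

open scoped BigOperators ComplexConjugate Matrix Matrix.Norms.L2Operator

namespace Summit.QuantumFields.BalabanUV.T4Continuum.RegionGramTwoLevel

open Literature.MathematicalPhysics.QuantumFieldTheory.Balaban1983to89.B5Prop11Plancherel (Tor fine)
open Literature.MathematicalPhysics.QuantumFieldTheory.Balaban1983to89.B5Prop11Lower (nsq nsq_nonneg)
open Literature.MathematicalPhysics.QuantumFieldTheory.Balaban1983to89.B5Block118 (QsOp)
open Literature.MathematicalPhysics.QuantumFieldTheory.Balaban1983to89.B5Blocks16 (blockOf)
open Literature.MathematicalPhysics.QuantumFieldTheory.Balaban1983to89.B5G183RateUnitTower (lev)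
open Summit.QuantumFields.BalabanUV.T4Continuum
open Summit.QuantumFields.BalabanUV.T4Continuum.BalabanAveragedTowerUnit (one_le_lev' cast_lev')
open Summit.QuantumFields.BalabanUV.T4Continuum.SubtypeCompression (toBlock_mul_of_vanish_left toBlock_mul_of_vanish_right toBlock_smul
  toBlock_conjTranspose toBlock_one)
open Summit.QuantumFields.BalabanUV.T4Continuum.ScalarBlockPoincare (QsOp_apply_blockOf)
open Summit.QuantumFields.BalabanUV.T4Continuum.ScalarBlockPlanting (Qavg0 JK0 JK0_conjTranspose_mul_JK0)
open Summit.QuantumFields.BalabanUV.T4Continuum.ScalarAveragedPropagator (gammaPs gammaPs_pos opNorm_le_of_nsq_le_rect)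
open Summit.QuantumFields.BalabanUV.T4Continuum.ScalarAveragedCompression (sigma0 sigma0_pos)
open Summit.QuantumFields.BalabanUV.T4Continuum.RegionScalarCompression (QOm GOm KcompR nsq_QOm_mulVec_le opNorm_KcompR_inv_le
  isUnit_det_KcompR)
open Summit.QuantumFields.BalabanUV.T4Continuum.GaugeTermScalarData (QsOp_mul_Qavg0)
open Summit.QuantumFields.BalabanUV.T4Continuum.DirichletScalarTowerBox (eqv Cbox_nonneg)
open Summit.QuantumFields.BalabanUV.Beta.GAN24.DirichletBoxCompression (DOm JOm refineR JK0_vanish_left JK0_vanish_right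
  opNorm_inv_DOm_le isUnit_det_DOm)
open Summit.QuantumFields.BalabanUV.Beta.GAN24.DirichletBoxTrace (blockReg)
open Summit.QuantumFields.BalabanUV.Beta.GAN24.DirichletBoxTwoLevelCore (refineR_blockReg_iff)
open Summit.QuantumFields.BalabanUV.Beta.GAN24.DirichletBoxTwoLevel (IsCoordBox Cbox injected_le_box)

variable {d : ℕ} (n R : ℕ) [NeZero n] [NeZero R] (M : Fin d → ℕ) [hM : ∀ μ, NeZero (M μ)] (a' : ℝ) (S : Tor M → Prop) [DecidablePred S]

/-! ## §1 One step `n ↦ R·n`: the nesting of the block averaging through the region, in the q-spelling -/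

omit [DecidablePred S] in
/-- the fine region in road P2's q-spelling `par⁻¹Ω` is the fine block region `blockReg (R·n) S`, pointwise. [folklore] -/
theorem fine_iff (x : Tor (fine (R * n) M)) : blockReg (R * n) M S x ↔ refineR n R M (blockReg n M S) x :=
  (refineR_blockReg_iff n R M S x).symm

omit [DecidablePred S] in
/-- the q-spelt objects are the standard ones re-indexed along `eqv` (definitional). [folklore] -/
theorem QOmq_eq_submatrix :
    ((QsOp (R * n) M).toBlock S (refineR n R M (blockReg n M S)))
      = (QOm (R * n) M S).submatrix id (eqv (fine_iff n R M S)) := rfl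

/-- the q-spelt fine propagator is the standard one re-indexed along `eqv`. [folklore] -/
theorem GOmq_eq_submatrix :
    (DOm (R * n) M a' (refineR n R M (blockReg n M S)))⁻¹ = (GOm (R * n) M a' S).submatrix (eqv (fine_iff n R M S)) (eqv (fine_iff n R M S)) := by
  have e : DOm (R * n) M a' (refineR n R M (blockReg n M S))
      = (DOm (R * n) M a' (blockReg (R * n) M S)).submatrix (eqv (fine_iff n R M S)) (eqv (fine_iff n R M S)) := rfl
  rw [e, Matrix.inv_submatrix_equiv]
  rfl

/-- **THE FINE GRAM MATRIX IN THE q-SPELLING**: `KcompR (R·n) M a′ S = (R·n)^d•(Q′q·G′q·G′q·Q′qᴴ)` — the index type `{y // S y}` is the same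
at both levels, the inner re-indexing cancels. [folklore] -/
theorem KcompR_fine_eq_q : KcompR (R * n) M a' S
    = (((R * n : ℕ) : ℂ) ^ d) • (((QsOp (R * n) M).toBlock S (refineR n R M (blockReg n M S))) * (DOm (R * n) M a' (refineR n R M (blockReg n M S)))⁻¹ * (DOm (R * n) M a' (refineR n R M (blockReg n M S)))⁻¹ * (((QsOp (R * n) M).toBlock S (refineR n R M (blockReg n M S))))ᴴ) := by
  rw [QOmq_eq_submatrix, GOmq_eq_submatrix, Matrix.conjTranspose_submatrix, Matrix.submatrix_mul_equiv, Matrix.submatrix_mul_equiv,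
    Matrix.submatrix_mul_equiv, Matrix.submatrix_id_id]
  rfl

omit [DecidablePred S] in
/-- `Q′_n` never couples a block of `S` to a site outside `Ω = blockReg n S`. [folklore] -/
theorem QsOp_vanish : ∀ (y : Tor M) (x : Tor (fine n M)), S y → ¬ blockReg n M S x → QsOp n M y x = 0 := by
  intro y x hy hx
  rw [QsOp_apply_blockOf, if_neg]
  intro h
  exact hx (show S (blockOf n M x) by rw [h]; exact hy)

omit [NeZero n] hM in
/-- `Q₀ = (√(R^d))⁻¹•J₀ᴴ` (King's scalar planting is the isometrically normalised adjoint of the one-step block averaging). [folklore] -/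
theorem Qavg0_eq_smul_JK0_conjTranspose :
    Qavg0 n R M = ((((Real.sqrt ((R : ℝ) ^ d)) : ℝ) : ℂ))⁻¹ • (JK0 n R M)ᴴ := by
  have hpos : 0 < Real.sqrt ((R : ℝ) ^ d) := Real.sqrt_pos.mpr (pow_pos (Nat.cast_pos.mpr (Nat.pos_of_ne_zero (NeZero.ne R))) d)
  have hs : ((((Real.sqrt ((R : ℝ) ^ d)) : ℝ) : ℂ)) ≠ 0 := Complex.ofReal_ne_zero.mpr hpos.ne'
  rw [JK0, Matrix.conjTranspose_smul, Matrix.conjTranspose_conjTranspose, smul_smul, Complex.star_def, Complex.conj_ofReal,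
    inv_mul_cancel₀ hs, one_smul]

/-- **THE NESTING THROUGH THE REGION**: `Q′q = (√(R^d))⁻¹•(Q′_Ω·J_Ωᴴ)`. [folklore] -/
theorem QOmq_eq : ((QsOp (R * n) M).toBlock S (refineR n R M (blockReg n M S)))
    = ((((Real.sqrt ((R : ℝ) ^ d)) : ℝ) : ℂ))⁻¹ • (QOm n M S * (JOm n R M (blockReg n M S))ᴴ) := by
  unfold QOm JOm
  rw [← QsOp_mul_Qavg0 M n R, toBlock_mul_of_vanish_left S (blockReg n M S) (refineR n R M (blockReg n M S)) _ _ (QsOp_vanish n M S),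
    Qavg0_eq_smul_JK0_conjTranspose, toBlock_smul, Matrix.mul_smul, toBlock_conjTranspose]

/-- **`J_ΩᴴJ_Ω = 1`** on `Ω`: every child of an `Ω`-site lies in `Ω′`, so the compressed planting is still an isometry. [folklore] -/
theorem JOm_conjTranspose_mul_JOm : (JOm n R M (blockReg n M S))ᴴ * JOm n R M (blockReg n M S) = 1 := by
  unfold JOm
  rw [toBlock_conjTranspose, ← toBlock_mul_of_vanish_right (blockReg n M S) (refineR n R M (blockReg n M S)) (blockReg n M S) _ _
    (JK0_vanish_right n R M (blockReg n M S)), JK0_conjTranspose_mul_JK0, toBlock_one]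

/-- `‖J_Ω‖ ≤ 1` and `‖J_Ωᴴ‖ ≤ 1`. [folklore] -/
theorem opNorm_JOm_conjTranspose_le : ‖(JOm n R M (blockReg n M S))ᴴ‖ ≤ 1 := by
  rw [Matrix.l2_opNorm_conjTranspose]
  refine opNorm_le_of_nsq_le_rect _ zero_le_one fun v => ?_
  have h : nsq (JOm n R M (blockReg n M S) *ᵥ v) = nsq v := by
    have e := Literature.MathematicalPhysics.QuantumFieldTheory.Balaban1983to89.B5Prop11Lower.star_dotProduct_self
      (JOm n R M (blockReg n M S) *ᵥ v)
    rw [Literature.MathematicalPhysics.QuantumFieldTheory.Balaban1983to89.B5Action121.star_mulVec_dotProduct, Matrix.mulVec_mulVec,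
      JOm_conjTranspose_mul_JOm, Matrix.one_mulVec,
      Literature.MathematicalPhysics.QuantumFieldTheory.Balaban1983to89.B5Prop11Lower.star_dotProduct_self] at e
    exact_mod_cast e.symm
  rw [h, one_pow, one_mul]

omit [NeZero n] in
/-- `(R·n)^d·conj((√(R^d))⁻¹)·(√(R^d))⁻¹ = n^d` in `ℂ`. [folklore] -/
theorem scale_identity : (((R * n : ℕ) : ℂ) ^ d) * (star ((((Real.sqrt ((R : ℝ) ^ d)) : ℝ) : ℂ))⁻¹ * ((((Real.sqrt ((R : ℝ) ^ d)) : ℝ) : ℂ))⁻¹)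
    = ((n : ℂ) ^ d) := by
  have hRpos : (0 : ℝ) < (R : ℝ) ^ d := pow_pos (Nat.cast_pos.mpr (Nat.pos_of_ne_zero (NeZero.ne R))) d
  have hR : ((R : ℂ) ^ d) ≠ 0 := pow_ne_zero d (by exact_mod_cast NeZero.ne R)
  have hss : ((((Real.sqrt ((R : ℝ) ^ d)) : ℝ) : ℂ)) * (((Real.sqrt ((R : ℝ) ^ d)) : ℝ) : ℂ) = (R : ℂ) ^ d := by
    rw [← Complex.ofReal_mul, Real.mul_self_sqrt hRpos.le]; push_cast; rfl
  rw [Complex.star_def, ← Complex.ofReal_inv, Complex.conj_ofReal, Complex.ofReal_inv, ← mul_inv, hss]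
  push_cast
  rw [mul_pow, mul_comm ((R : ℂ) ^ d), mul_assoc, mul_inv_cancel₀ hR, mul_one]

/-- **THE FINE GRAM MATRIX THROUGH THE COARSE AVERAGING**: `KcompR (R·n) = n^d•(Q′_Ω·(J_ΩᴴG′G′J_Ω)·Q′_Ωᴴ)`. [folklore] -/
theorem KcompR_fine_eq : KcompR (R * n) M a' S
    = ((n : ℂ) ^ d) • (QOm n M S * ((JOm n R M (blockReg n M S))ᴴ * (DOm (R * n) M a' (refineR n R M (blockReg n M S)))⁻¹ * (DOm (R * n) M a' (refineR n R M (blockReg n M S)))⁻¹ * JOm n R M (blockReg n M S))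
        * (QOm n M S)ᴴ) := by
  have h1 := KcompR_fine_eq_q n R M a' S
  have h2 := QOmq_eq n R M S
  have h3 : (((QsOp (R * n) M).toBlock S (refineR n R M (blockReg n M S))))ᴴ = star (((((Real.sqrt ((R : ℝ) ^ d)) : ℝ) : ℂ))⁻¹) • (JOm n R M (blockReg n M S) * (QOm n M S)ᴴ) := by
    rw [h2, Matrix.conjTranspose_smul, Matrix.conjTranspose_mul, Matrix.conjTranspose_conjTranspose]
  rw [h1, h3, h2]
  simp only [Matrix.smul_mul, Matrix.mul_smul, smul_smul, Matrix.mul_assoc]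
  rw [scale_identity n R]

/-! ## §2 The difference of the Gram matrices -/

/-- **`K_{Rn} − K_n = n^d•(Q′_Ω·X·Q′_Ωᴴ)`**, `X = J_ΩᴴG′(G′J_Ω − J_ΩG) + J_Ωᴴ(G′J_Ω − J_ΩG)G` (using `J_ΩᴴJ_Ω = 1`). [folklore] -/
theorem KcompR_fine_sub_eq : KcompR (R * n) M a' S - KcompR n M a' S
    = ((n : ℂ) ^ d) • (QOm n M S
        * ((JOm n R M (blockReg n M S))ᴴ * (DOm (R * n) M a' (refineR n R M (blockReg n M S)))⁻¹
              * ((DOm (R * n) M a' (refineR n R M (blockReg n M S)))⁻¹ * JOm n R M (blockReg n M S) - JOm n R M (blockReg n M S) * GOm n M a' S)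
            + (JOm n R M (blockReg n M S))ᴴ
              * ((DOm (R * n) M a' (refineR n R M (blockReg n M S)))⁻¹ * JOm n R M (blockReg n M S) - JOm n R M (blockReg n M S) * GOm n M a' S) * GOm n M a' S)
        * (QOm n M S)ᴴ) := by
  have hJ := JOm_conjTranspose_mul_JOm n R M S
  set J := JOm n R M (blockReg n M S) with hJdef
  set G := GOm n M a' S with hGdef
  set G' := (DOm (R * n) M a' (refineR n R M (blockReg n M S)))⁻¹ with hG'def
  set Q := QOm n M S with hQdef
  have e : Q * G * G * Qᴴ = Q * (Jᴴ * J * G * G) * Qᴴ := by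
    rw [hJ, Matrix.one_mul, Matrix.mul_assoc Q G G]
  have inner : Jᴴ * G' * G' * J - Jᴴ * J * G * G = Jᴴ * G' * (G' * J - J * G) + Jᴴ * (G' * J - J * G) * G := by
    simp only [Matrix.mul_sub, Matrix.sub_mul, Matrix.mul_assoc]
    abel
  have key : Q * (Jᴴ * G' * G' * J) * Qᴴ - Q * G * G * Qᴴ = Q * (Jᴴ * G' * (G' * J - J * G) + Jᴴ * (G' * J - J * G) * G) * Qᴴ := by
    rw [e, ← Matrix.sub_mul, ← Matrix.mul_sub, inner]
  have hK : KcompR n M a' S = ((n : ℂ) ^ d) • (Q * G * G * Qᴴ) := rfl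
  rw [KcompR_fine_eq, hK, ← hJdef, ← hG'def, ← hQdef, ← smul_sub, key]

/-- `n^d·‖Q′_Ω‖² ≤ 1` (`Π′ ≤ 1` through the compression), as an operator-norm statement on `Q′_Ωᴴ`. [folklore] -/
theorem opNorm_QOm_conjTranspose_sq_le : (n : ℝ) ^ d * ‖(QOm n M S)ᴴ‖ ^ 2 ≤ 1 := by
  have hn : (0 : ℝ) < (n : ℝ) ^ d := pow_pos (Nat.cast_pos.mpr (Nat.pos_of_ne_zero (NeZero.ne n))) d
  have h1 : ‖QOm n M S‖ ≤ Real.sqrt (((n : ℝ) ^ d)⁻¹) := by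
    refine opNorm_le_of_nsq_le_rect _ (Real.sqrt_nonneg _) fun v => ?_
    rw [Real.sq_sqrt (inv_nonneg.mpr hn.le)]
    have h := nsq_QOm_mulVec_le n M S v
    calc nsq (QOm n M S *ᵥ v) = ((n : ℝ) ^ d)⁻¹ * ((n : ℝ) ^ d * nsq (QOm n M S *ᵥ v)) := by
          rw [← mul_assoc, inv_mul_cancel₀ hn.ne', one_mul]
      _ ≤ ((n : ℝ) ^ d)⁻¹ * nsq v := mul_le_mul_of_nonneg_left h (inv_nonneg.mpr hn.le)
  rw [Matrix.l2_opNorm_conjTranspose]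
  have h2 : ‖QOm n M S‖ ^ 2 ≤ ((n : ℝ) ^ d)⁻¹ := by
    calc ‖QOm n M S‖ ^ 2 ≤ (Real.sqrt (((n : ℝ) ^ d)⁻¹)) ^ 2 := pow_le_pow_left₀ (norm_nonneg _) h1 2
      _ = ((n : ℝ) ^ d)⁻¹ := Real.sq_sqrt (inv_nonneg.mpr hn.le)
  calc (n : ℝ) ^ d * ‖QOm n M S‖ ^ 2 ≤ (n : ℝ) ^ d * ((n : ℝ) ^ d)⁻¹ := mul_le_mul_of_nonneg_left h2 hn.le
    _ = 1 := mul_inv_cancel₀ hn.ne'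

/-- **THE DIFFERENCE OF THE GRAM MATRICES FROM THE INJECTED NUMBER** (ANY region `S`, `a′ > 0`): if `‖G′J_Ω − J_ΩG‖ ≤ ε` then
`‖K_{Rn} − K_n‖ ≤ 2γ′⁻¹·ε`. [folklore] -/
theorem opNorm_KcompR_sub_le_of_injected (ha' : 0 < a') {ε : ℝ}
    (hε : ‖(DOm (R * n) M a' (refineR n R M (blockReg n M S)))⁻¹ * JOm n R M (blockReg n M S) - JOm n R M (blockReg n M S) * GOm n M a' S‖ ≤ ε) :
    ‖KcompR (R * n) M a' S - KcompR n M a' S‖ ≤ 2 * (gammaPs d a')⁻¹ * ε := by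
  have hε0 : 0 ≤ ε := le_trans (norm_nonneg _) hε
  have hγ : 0 ≤ (gammaPs d a')⁻¹ := inv_nonneg.mpr (gammaPs_pos (d := d) (a' := a')).1.le
  have hG : ‖GOm n M a' S‖ ≤ (gammaPs d a')⁻¹ := opNorm_inv_DOm_le n M a' (blockReg n M S) ha'
  have hG' : ‖(DOm (R * n) M a' (refineR n R M (blockReg n M S)))⁻¹‖ ≤ (gammaPs d a')⁻¹ := opNorm_inv_DOm_le (R * n) M a' _ ha'
  have hJ : ‖(JOm n R M (blockReg n M S))ᴴ‖ ≤ 1 := opNorm_JOm_conjTranspose_le n R M S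
  set J := JOm n R M (blockReg n M S) with hJdef
  set D := (DOm (R * n) M a' (refineR n R M (blockReg n M S)))⁻¹ * J - J * GOm n M a' S with hD
  set X := Jᴴ * (DOm (R * n) M a' (refineR n R M (blockReg n M S)))⁻¹ * D + Jᴴ * D * GOm n M a' S with hX
  -- `‖X‖ ≤ γ′⁻¹ε + εγ′⁻¹`
  have hX1 : ‖Jᴴ * (DOm (R * n) M a' (refineR n R M (blockReg n M S)))⁻¹ * D‖ ≤ (gammaPs d a')⁻¹ * ε := by
    calc ‖Jᴴ * (DOm (R * n) M a' (refineR n R M (blockReg n M S)))⁻¹ * D‖ ≤ ‖Jᴴ * (DOm (R * n) M a' (refineR n R M (blockReg n M S)))⁻¹‖ * ‖D‖ := Matrix.l2_opNorm_mul _ _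
      _ ≤ (‖Jᴴ‖ * ‖(DOm (R * n) M a' (refineR n R M (blockReg n M S)))⁻¹‖) * ‖D‖ := mul_le_mul_of_nonneg_right (Matrix.l2_opNorm_mul _ _) (norm_nonneg _)
      _ ≤ (1 * (gammaPs d a')⁻¹) * ε := by gcongr
      _ = (gammaPs d a')⁻¹ * ε := by ring
  have hX2 : ‖Jᴴ * D * GOm n M a' S‖ ≤ ε * (gammaPs d a')⁻¹ := by
    calc ‖Jᴴ * D * GOm n M a' S‖ ≤ ‖Jᴴ * D‖ * ‖GOm n M a' S‖ := Matrix.l2_opNorm_mul _ _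
      _ ≤ (‖Jᴴ‖ * ‖D‖) * ‖GOm n M a' S‖ := mul_le_mul_of_nonneg_right (Matrix.l2_opNorm_mul _ _) (norm_nonneg _)
      _ ≤ (1 * ε) * (gammaPs d a')⁻¹ := by gcongr
      _ = ε * (gammaPs d a')⁻¹ := by ring
  have hXle : ‖X‖ ≤ 2 * (gammaPs d a')⁻¹ * ε := by
    calc ‖X‖ ≤ ‖Jᴴ * (DOm (R * n) M a' (refineR n R M (blockReg n M S)))⁻¹ * D‖ + ‖Jᴴ * D * GOm n M a' S‖ := norm_add_le _ _
      _ ≤ (gammaPs d a')⁻¹ * ε + ε * (gammaPs d a')⁻¹ := add_le_add hX1 hX2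
      _ = 2 * (gammaPs d a')⁻¹ * ε := by ring
  -- `‖n^d•(Q X Qᴴ)‖ ≤ n^d‖Qᴴ‖²‖X‖ ≤ ‖X‖`
  have hn : (0 : ℝ) ≤ (n : ℝ) ^ d := pow_nonneg (Nat.cast_nonneg _) d
  have hQ := opNorm_QOm_conjTranspose_sq_le n M S
  rw [KcompR_fine_sub_eq, ← hJdef, ← hD, ← hX, Matrix.l2_opNorm_def, map_smul, norm_smul, norm_pow, Complex.norm_natCast,
    ← Matrix.l2_opNorm_def]
  calc (n : ℝ) ^ d * ‖QOm n M S * X * (QOm n M S)ᴴ‖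
      ≤ (n : ℝ) ^ d * (‖QOm n M S‖ * ‖X‖ * ‖(QOm n M S)ᴴ‖) := by
        refine mul_le_mul_of_nonneg_left ?_ hn
        calc ‖QOm n M S * X * (QOm n M S)ᴴ‖ ≤ ‖QOm n M S * X‖ * ‖(QOm n M S)ᴴ‖ := Matrix.l2_opNorm_mul _ _
          _ ≤ ‖QOm n M S‖ * ‖X‖ * ‖(QOm n M S)ᴴ‖ := mul_le_mul_of_nonneg_right (Matrix.l2_opNorm_mul _ _) (norm_nonneg _)
    _ = ((n : ℝ) ^ d * ‖(QOm n M S)ᴴ‖ ^ 2) * ‖X‖ := by rw [Matrix.l2_opNorm_conjTranspose]; ring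
    _ ≤ 1 * ‖X‖ := mul_le_mul_of_nonneg_right hQ (norm_nonneg _)
    _ ≤ 2 * (gammaPs d a')⁻¹ * ε := by rw [one_mul]; exact hXle

/-- **THE TWO-LEVEL LAW OF THE GRAM MATRIX ON A COORDINATE BOX**: `‖K_{Rn} − K_n‖ ≤ 2γ′⁻¹·Cbox d R a′/n` — road P2's box END
`injected_le_box` BY NAME. [folklore] -/
theorem opNorm_KcompR_sub_le_box (hS : IsCoordBox M S) (hn : 1 ≤ n) (ha' : 0 < a') :
    ‖KcompR (R * n) M a' S - KcompR n M a' S‖ ≤ 2 * (gammaPs d a')⁻¹ * (Cbox d R a' / n) := by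
  have h := injected_le_box n R M S hS hn ha'
  have e1 : (DOm (R * n) M a' (refineR n R M (blockReg n M S)))⁻¹ = (DOm (R * n) M a' (refineR n R M (blockReg n M S)))⁻¹ := rfl
  have e2 : (DOm n M a' (blockReg n M S))⁻¹ = GOm n M a' S := rfl
  rw [e1, e2] at h
  exact opNorm_KcompR_sub_le_of_injected n R M a' S ha' h

/-! ## §3 The inverses, and the law along the tower -/

/-- **THE TWO-LEVEL LAW OF THE INVERSE GRAM MATRIX ON A COORDINATE BOX**:
`‖K_{Rn}⁻¹ − K_n⁻¹‖ ≤ (σ₀²)⁻¹·(σ₀²)⁻¹·(2γ′⁻¹·Cbox d R a′/n)` (`K′⁻¹ − K⁻¹ = K′⁻¹(K − K′)K⁻¹`). [folklore] -/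
theorem opNorm_KcompR_inv_sub_le_box (hS : IsCoordBox M S) (hn : 1 ≤ n) (ha' : 0 < a') :
    ‖(KcompR (R * n) M a' S)⁻¹ - (KcompR n M a' S)⁻¹‖
      ≤ ((sigma0 d a') ^ 2)⁻¹ * ((sigma0 d a') ^ 2)⁻¹ * (2 * (gammaPs d a')⁻¹ * (Cbox d R a' / n)) := by
  have hK' := isUnit_det_KcompR (R * n) M a' S ha'
  have hK := isUnit_det_KcompR n M a' S ha'
  have h1 : (KcompR (R * n) M a' S)⁻¹ * (KcompR n M a' S - KcompR (R * n) M a' S) * (KcompR n M a' S)⁻¹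
      = (KcompR (R * n) M a' S)⁻¹ - (KcompR n M a' S)⁻¹ := by
    rw [Matrix.mul_sub, Matrix.sub_mul, Matrix.mul_assoc, Matrix.mul_nonsing_inv _ hK, Matrix.mul_one, Matrix.nonsing_inv_mul _ hK',
      Matrix.one_mul]
  rw [← h1]
  have hσ : 0 ≤ ((sigma0 d a') ^ 2)⁻¹ := inv_nonneg.mpr (sq_nonneg _)
  have hdiff : ‖KcompR n M a' S - KcompR (R * n) M a' S‖ ≤ 2 * (gammaPs d a')⁻¹ * (Cbox d R a' / n) := by
    rw [← norm_neg, neg_sub]; exact opNorm_KcompR_sub_le_box n R M a' S hS hn ha'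
  have hA := opNorm_KcompR_inv_le (R * n) M a' S ha'
  have hC := opNorm_KcompR_inv_le n M a' S ha'
  have hb0 : 0 ≤ 2 * (gammaPs d a')⁻¹ * (Cbox d R a' / n) := le_trans (norm_nonneg _) hdiff
  calc ‖(KcompR (R * n) M a' S)⁻¹ * (KcompR n M a' S - KcompR (R * n) M a' S) * (KcompR n M a' S)⁻¹‖
      ≤ ‖(KcompR (R * n) M a' S)⁻¹ * (KcompR n M a' S - KcompR (R * n) M a' S)‖ * ‖(KcompR n M a' S)⁻¹‖ := Matrix.l2_opNorm_mul _ _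
    _ ≤ (‖(KcompR (R * n) M a' S)⁻¹‖ * ‖KcompR n M a' S - KcompR (R * n) M a' S‖) * ‖(KcompR n M a' S)⁻¹‖ :=
        mul_le_mul_of_nonneg_right (Matrix.l2_opNorm_mul _ _) (norm_nonneg _)
    _ ≤ (((sigma0 d a') ^ 2)⁻¹ * (2 * (gammaPs d a')⁻¹ * (Cbox d R a' / n))) * ((sigma0 d a') ^ 2)⁻¹ :=
        mul_le_mul (mul_le_mul hA hdiff (norm_nonneg _) hσ) hC (norm_nonneg _) (mul_nonneg hσ hb0)
    _ = _ := by ring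

/-- the constant of the law along the tower, `Cgram = (σ₀²)⁻¹·(σ₀²)⁻¹·(2γ′⁻¹·Cbox d L a′)` (level-free), is nonnegative. [folklore] -/
theorem Cgram_nonneg (L : ℕ) : 0 ≤ ((sigma0 d a') ^ 2)⁻¹ * ((sigma0 d a') ^ 2)⁻¹ * (2 * (gammaPs d a')⁻¹ * Cbox d L a') := by
  have hγ : 0 ≤ (gammaPs d a')⁻¹ := inv_nonneg.mpr (gammaPs_pos (d := d) (a' := a')).1.le
  have hC := Cbox_nonneg (d := d) a' L
  positivity

/-- **(W-c) ALONG THE TOWER** `n_k = lev L k = L^k`: on every coordinate box, for every `k`,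
`‖(KcompR (lev L (k+1)) M a′ S)⁻¹ − (KcompR (lev L k) M a′ S)⁻¹‖ ≤ Cgram d L a′·(L⁻¹)^k` — the region Gram matrices of [B9] (3.25) at two
consecutive spacings differ by the torus rate, with a level-free constant. [folklore] -/
theorem opNorm_KcompR_inv_sub_le_lev (L : ℕ) [NeZero L] (hS : IsCoordBox M S) (ha' : 0 < a') (k : ℕ) :
    ‖(KcompR (lev L (k + 1)) M a' S)⁻¹ - (KcompR (lev L k) M a' S)⁻¹‖
      ≤ ((sigma0 d a') ^ 2)⁻¹ * ((sigma0 d a') ^ 2)⁻¹ * (2 * (gammaPs d a')⁻¹ * Cbox d L a') * ((L : ℝ)⁻¹) ^ k := by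
  have h := opNorm_KcompR_inv_sub_le_box (lev L k) L M a' S hS (one_le_lev' L k) ha'
  rw [cast_lev'] at h
  have e : ((sigma0 d a') ^ 2)⁻¹ * ((sigma0 d a') ^ 2)⁻¹ * (2 * (gammaPs d a')⁻¹ * (Cbox d L a' / (L : ℝ) ^ k))
      = ((sigma0 d a') ^ 2)⁻¹ * ((sigma0 d a') ^ 2)⁻¹ * (2 * (gammaPs d a')⁻¹ * Cbox d L a') * ((L : ℝ)⁻¹) ^ k := by
    rw [inv_pow, div_eq_mul_inv]; ring
  rw [← e]
  exact h

/-- the same for the Gram matrices themselves: `‖KcompR (lev L (k+1)) − KcompR (lev L k)‖ ≤ 2γ′⁻¹·Cbox d L a′·(L⁻¹)^k`. [folklore] -/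
theorem opNorm_KcompR_sub_le_lev (L : ℕ) [NeZero L] (hS : IsCoordBox M S) (ha' : 0 < a') (k : ℕ) :
    ‖KcompR (lev L (k + 1)) M a' S - KcompR (lev L k) M a' S‖ ≤ 2 * (gammaPs d a')⁻¹ * Cbox d L a' * ((L : ℝ)⁻¹) ^ k := by
  have h := opNorm_KcompR_sub_le_box (lev L k) L M a' S hS (one_le_lev' L k) ha'
  rw [cast_lev'] at h
  have e : 2 * (gammaPs d a')⁻¹ * (Cbox d L a' / (L : ℝ) ^ k) = 2 * (gammaPs d a')⁻¹ * Cbox d L a' * ((L : ℝ)⁻¹) ^ k := by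
    rw [inv_pow, div_eq_mul_inv]; ring
  rw [← e]
  exact h

end Summit.QuantumFields.BalabanUV.T4Continuum.RegionGramTwoLevel

end
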